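import Summits.QuantumFields.YangMills.Theorems.BalabanLadderIRClauseILocalityShell
import Summits.QuantumFields.YangMills.Theorems.BalabanLadderIRHereditaryUpgrade
import HarnessLib

/-!
# Crux `IR` (stmt-QuantumFields-19354), slot `af-pincer-Uc` (d9d9d710e4ae01bd), stub `stub_onsetUcSC`: clause (i) from a
# SINGLE-SHELL-CELL influence bound (telescoping over the shell cells through typical hybrids)

Helper module for item `stmt-QuantumFields-19354` (`--supports`; it closes nothing); lead prover of the line (lane A bookkeeping).
Route-independent (tree constants `FixedMesh.ClauseI`, `Tempered.cellEdges/windowCells/regionEdges`, `ShellTempered.windowCellsPlus/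
shellEdges`, infvol-p3's `FixedMesh.clauseI_iff_shell_pairs`).

By `clauseI_iff_rim_shell_pairs` (Theorems/BalabanLadderIRClauseILocalityShell) clause (i) at `(β, w, n, ε, Typ)` is the statement
that the centre-cell law under the kernel of any rim-reaching cell union `Y ∋ 0` moves by `≤ ε` between two exterior data that are
typical off `Y` and differ only on the SHELL `shellEdges w n`.  This file TELESCOPES that difference through the shell cells:

* §1 `cellHybrid w D σ σ'` (`σ'` on the cells of `D`, `σ` elsewhere) and its bookkeeping on a frame with pairwise disjoint cells
  (`cellHybrid_eq_on_cell_of_mem` / `_of_not_mem`, `cellHybrid_insert_eq_off`, `cellHybrid_shell_eq`: the hybrid over ALL shell cells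
  of a pair differing only on the shell IS the second datum);
* §2 `abs_sub_le_card_mul_of_singleCell` — the abstract telescoping: if a functional `Φ` moves by `≤ η` between ADMISSIBLE data differing
  on ONE cell of `S`, and all hybrids are admissible, then `|Φ σ − Φ (cellHybrid w D σ σ')| ≤ #D · η` for `D ⊆ S`;
* §3 **`clauseI_of_singleShellCellInfluence`** — for a cell-local class: a SINGLE-SHELL-CELL influence bound `η` (centre-cell law under
  `γ_{regionEdges w Y}` moves by `≤ η` when two data, both typical off `Y`, differ only on the links of ONE shell cell) gives
  `ClauseI ρ β w n (#shell · η) Typ`, `#shell = #(windowCellsPlus n \ windowCells n)` (`= shellCount n = (4n+3)⁴ − (4n+1)⁴`).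
  So the format's admissibility `ε · shellCount n ≤ 3/4` is met by a single-cell influence `η ≤ 3 / (4 · shellCount n ^ 2)` — for `n = 1`:
  `η ≤ 3 / (4 · 1776²) ≈ 2.4 · 10⁻⁷`.  This is the located NUMBER behind conjunct (b) of the lead's `ClauseIWorkingClassAtOnset`: the
  influence of ONE cell at cell-distance `2n+1` on the centre cell, through any rim-reaching resampled region, at mesh `b(β, δ) → ∞`,
  uniformly over typical data.

HONEST FRAMING: a telescoping identity; the single-cell influence bound at a β-dependent mesh is the research content (weak-coupling
mixing of 4-d non-abelian lattice gauge theory beyond the correlation length, simply connected `G`) and is NOT claimed.  Not a gap, not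
Clay.  No `sorry`; axioms ⊆ {propext, Classical.choice, Quot.sound}.
-/

set_option autoImplicit false

noncomputable section

open MeasureTheory
open Literature.MathematicalPhysics.QuantumLattice
open Literature.Probability.LatticeModels
open Summit.QuantumFields.YangMills.Cruxes.IR.Tempered (cellEdges windowCells regionEdges)
open Summit.QuantumFields.YangMills.Cruxes.IR.ShellTempered (windowCellsPlus shellEdges)
open Summit.QuantumFields.YangMills.Cruxes.IR.FixedMesh (ClauseI clauseI_iff_shell_pairs width_one_of_isFrame)
open Summit.QuantumFields.YangMills.Cruxes.IR.OnsetFormatsUc (IsFrame)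
open Summit.QuantumFields.YangMills.Theorems.OddTorusChessboard (grid_monotone)
open Summit.QuantumFields.YangMills.Theorems.IRRarityUpgrade (disjoint_cellEdges)

namespace Summit.QuantumFields.YangMills.Cruxes.IR.AfPincerUc.SingleCell

variable {G : Type}

/-! ## §1 Hybrid exterior data -/

/-- **Hybrid datum**: `σ'` on the links of the cells of `D`, `σ` elsewhere. -/
def cellHybrid (w : Fin 4 → ℤ → ℤ) (D : Finset (Fin 4 → ℤ)) (σ σ' : LGConfig 4 G) : LGConfig 4 G :=
  fun e => if e ∈ regionEdges w D then σ' e else σ e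

/-- The empty hybrid is the first datum. -/
theorem cellHybrid_empty (w : Fin 4 → ℤ → ℤ) (σ σ' : LGConfig 4 G) : cellHybrid w ∅ σ σ' = σ := by
  funext e
  simp [cellHybrid, Summit.QuantumFields.YangMills.Cruxes.IR.Tempered.regionEdges]

/-- On a cell of `D` the hybrid is the second datum. -/
theorem cellHybrid_eq_on_cell_of_mem (w : Fin 4 → ℤ → ℤ) {D : Finset (Fin 4 → ℤ)} {c : Fin 4 → ℤ} (hc : c ∈ D)
    (σ σ' : LGConfig 4 G) : ∀ e ∈ cellEdges w c, cellHybrid w D σ σ' e = σ' e := by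
  intro e he
  have h : e ∈ regionEdges w D := Finset.mem_biUnion.2 ⟨c, hc, he⟩
  simp [cellHybrid, h]

/-- On a cell NOT in `D` (pairwise disjoint cells) the hybrid is the first datum. -/
theorem cellHybrid_eq_on_cell_of_not_mem {w : Fin 4 → ℤ → ℤ} (hmono : ∀ i, Monotone (w i)) {D : Finset (Fin 4 → ℤ)}
    {c : Fin 4 → ℤ} (hc : c ∉ D) (σ σ' : LGConfig 4 G) : ∀ e ∈ cellEdges w c, cellHybrid w D σ σ' e = σ e := by
  intro e he
  have h : e ∉ regionEdges w D := by
    intro h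
    obtain ⟨c', hc', he'⟩ := Finset.mem_biUnion.1 h
    have hne : c ≠ c' := fun hcc => hc (hcc ▸ hc')
    exact Finset.disjoint_left.1 (disjoint_cellEdges hmono hne) he he'
  simp [cellHybrid, h]

/-- Adding one cell changes the hybrid only on that cell's links. -/
theorem cellHybrid_insert_eq_off [DecidableEq (Fin 4 → ℤ)] (w : Fin 4 → ℤ → ℤ) (D : Finset (Fin 4 → ℤ)) (c : Fin 4 → ℤ)
    (σ σ' : LGConfig 4 G) : ∀ e ∉ cellEdges w c, cellHybrid w (insert c D) σ σ' e = cellHybrid w D σ σ' e := by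
  intro e he
  have h : e ∈ regionEdges w (insert c D) ↔ e ∈ regionEdges w D := by
    simp only [Summit.QuantumFields.YangMills.Cruxes.IR.Tempered.regionEdges, Finset.mem_biUnion, Finset.mem_insert]
    constructor
    · rintro ⟨c', hc' | hc', he'⟩
      · exact absurd (hc' ▸ he') he
      · exact ⟨c', hc', he'⟩
    · rintro ⟨c', hc', he'⟩
      exact ⟨c', Or.inr hc', he'⟩
  by_cases hD : e ∈ regionEdges w D
  · simp [cellHybrid, hD, h.2 hD]
  · have hI : e ∉ regionEdges w (insert c D) := fun h' => hD (h.1 h')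
    simp [cellHybrid, hD, hI]

/-- **The hybrid over ALL shell cells of a pair differing only on the shell is the second datum.** -/
theorem cellHybrid_shell_eq (w : Fin 4 → ℤ → ℤ) (n : ℕ) {σ σ' : LGConfig 4 G} (hsh : ∀ e ∉ shellEdges w n, σ e = σ' e) :
    cellHybrid w (windowCellsPlus n \ windowCells n) σ σ' = σ' := by
  funext e
  by_cases h : e ∈ regionEdges w (windowCellsPlus n \ windowCells n)
  · simp [cellHybrid, h]
  · simp only [cellHybrid, h, if_false]
    refine hsh e fun hes => h ?_
    -- a shell edge lies in a shell cell
    simp only [Summit.QuantumFields.YangMills.Cruxes.IR.ShellTempered.shellEdges, Finset.mem_sdiff,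
      Summit.QuantumFields.YangMills.Cruxes.IR.Tempered.regionEdges, Finset.mem_biUnion, not_exists, not_and] at hes ⊢
    obtain ⟨⟨c, hcP, hec⟩, hnot⟩ := hes
    exact ⟨c, ⟨hcP, fun hcW => hnot c hcW hec⟩, hec⟩

/-! ## §2 The abstract telescoping over cells -/

/-- **Telescoping.**  If `Φ` moves by at most `η` between ADMISSIBLE data (`P`) that differ only on the links of ONE cell of `S`, and
every hybrid `cellHybrid w D σ σ'` with `D ⊆ S` is admissible, then `|Φ σ − Φ (cellHybrid w D σ σ')| ≤ #D · η` for all `D ⊆ S`. -/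
theorem abs_sub_le_card_mul_of_singleCell (w : Fin 4 → ℤ → ℤ) (S : Finset (Fin 4 → ℤ)) (Φ : LGConfig 4 G → ℝ)
    (P : LGConfig 4 G → Prop) {η : ℝ}
    (hstep : ∀ c ∈ S, ∀ ζ ζ' : LGConfig 4 G, P ζ → P ζ' → (∀ e ∉ cellEdges w c, ζ e = ζ' e) → |Φ ζ - Φ ζ'| ≤ η)
    (σ σ' : LGConfig 4 G) (hP : ∀ D ⊆ S, P (cellHybrid w D σ σ')) :
    ∀ D ⊆ S, |Φ σ - Φ (cellHybrid w D σ σ')| ≤ D.card * η := by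
  classical
  intro D hD
  induction D using Finset.induction_on with
  | empty => simp [cellHybrid_empty]
  | insert c D hcD ih =>
    have hDS : D ⊆ S := fun x hx => hD (Finset.mem_insert_of_mem hx)
    have hcS : c ∈ S := hD (Finset.mem_insert_self c D)
    have h1 := ih hDS
    have h2 : |Φ (cellHybrid w D σ σ') - Φ (cellHybrid w (insert c D) σ σ')| ≤ η :=
      hstep c hcS _ _ (hP D hDS) (hP _ hD) fun e he => (cellHybrid_insert_eq_off w D c σ σ' e he).symm
    rw [Finset.card_insert_of_notMem hcD]
    push_cast
    calc |Φ σ - Φ (cellHybrid w (insert c D) σ σ')|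
        ≤ |Φ σ - Φ (cellHybrid w D σ σ')| + |Φ (cellHybrid w D σ σ') - Φ (cellHybrid w (insert c D) σ σ')| :=
          abs_sub_le _ _ _
      _ ≤ D.card * η + η := add_le_add h1 h2
      _ = (D.card + 1) * η := by ring

/-! ## §3 Clause (i) from a single-shell-cell influence bound -/

section Clause

variable [Group G] [TopologicalSpace G] [IsTopologicalGroup G] [CompactSpace G] [MeasurableSpace G] [BorelSpace G]
  {N : ℕ} (ρ : G →* Matrix (Fin N) (Fin N) ℂ)

/-- **Clause (i) from a SINGLE-SHELL-CELL influence bound.**  On a mesh-`b` frame (`b ≥ 1`), for a class that is cell-local on the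
window-plus-shell: if for every cell union `Y ∋ 0` of the window, every shell cell `c` and every two data typical off `Y` that differ
ONLY on the links of `c`, the centre-cell law under `γ_{regionEdges w Y}` moves by `≤ η`, then
`ClauseI ρ β w n (#(windowCellsPlus n \ windowCells n) · η) Typ`. -/
theorem clauseI_of_singleShellCellInfluence (hρ : Continuous ρ) {β : ℝ} {b : ℕ} (hb : 1 ≤ b) {w : Fin 4 → ℤ → ℤ}
    (hwf : IsFrame b w) {n : ℕ} {Typ : (Fin 4 → ℤ) → Set (LGConfig 4 G)}
    (hloc : ∀ c ∈ windowCellsPlus n, DependsOn (fun σ : LGConfig 4 G => σ ∈ Typ c) ↑(cellEdges w c)) {η : ℝ}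
    (h1 : ∀ Y : Finset (Fin 4 → ℤ), Y ⊆ windowCells n → (0 : Fin 4 → ℤ) ∈ Y →
      ∀ c ∈ windowCellsPlus n \ windowCells n, ∀ ζ ζ' : LGConfig 4 G,
        (∀ c' ∈ windowCellsPlus n, c' ∉ Y → ζ ∈ Typ c' ∧ ζ' ∈ Typ c') → (∀ e ∉ cellEdges w c, ζ e = ζ' e) →
        ∀ f : LGConfig 4 G → ℝ, IsCylinder f (cellEdges w 0) → Measurable f → (∀ U, 0 ≤ f U ∧ f U ≤ 1) →
          |(∫ U, f U ∂(ymSpecification ρ β (regionEdges w Y) ζ)) -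
            ∫ U, f U ∂(ymSpecification ρ β (regionEdges w Y) ζ')| ≤ η) :
    ClauseI ρ β w n (((windowCellsPlus n \ windowCells n).card : ℝ) * η) Typ := by
  classical
  have hw1 : ∀ i j, w i j + 1 ≤ w i (j + 1) := width_one_of_isFrame hb hwf
  have hwb : ∀ i j, w i j + ((b : ℕ) : ℤ) ≤ w i (j + 1) ∧ w i (j + 1) ≤ w i j + 2 * ((b : ℕ) : ℤ) := hwf
  have hmono : ∀ i, Monotone (w i) := grid_monotone hwb
  rw [clauseI_iff_shell_pairs ρ hρ hw1 hloc]
  intro Y hYw h0 σ σ' htyp hsh f hf hfm hf01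
  set S : Finset (Fin 4 → ℤ) := windowCellsPlus n \ windowCells n with hS
  -- admissibility of the hybrids: typical off `Y`
  have hP : ∀ D ⊆ S, ∀ c' ∈ windowCellsPlus n, c' ∉ Y → cellHybrid w D σ σ' ∈ Typ c' := by
    intro D _ c' hc' hc'Y
    by_cases hcD : c' ∈ D
    · have heq : (cellHybrid w D σ σ' ∈ Typ c') = (σ' ∈ Typ c') :=
        hloc c' hc' fun e he => cellHybrid_eq_on_cell_of_mem w hcD σ σ' e (Finset.mem_coe.1 he)
      exact heq.mpr (htyp c' hc' hc'Y).2
    · have heq : (cellHybrid w D σ σ' ∈ Typ c') = (σ ∈ Typ c') :=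
        hloc c' hc' fun e he => cellHybrid_eq_on_cell_of_not_mem hmono hcD σ σ' e (Finset.mem_coe.1 he)
      exact heq.mpr (htyp c' hc' hc'Y).1
  have key := abs_sub_le_card_mul_of_singleCell w S
    (fun ζ => ∫ U, f U ∂(ymSpecification ρ β (regionEdges w Y) ζ))
    (fun ζ => ∀ c' ∈ windowCellsPlus n, c' ∉ Y → ζ ∈ Typ c')
    (fun c hc ζ ζ' hζ hζ' hdiff => h1 Y hYw h0 c hc ζ ζ' (fun c' hc' hc'Y => ⟨hζ c' hc' hc'Y, hζ' c' hc' hc'Y⟩)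
      hdiff f hf hfm hf01)
    σ σ' hP S subset_rfl
  rwa [hS, cellHybrid_shell_eq w n hsh] at key

end Clause

end Summit.QuantumFields.YangMills.Cruxes.IR.AfPincerUc.SingleCell

end
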